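import Summits.Ventures.PackingBounds.Energy.SineGaussBinomial

/-!
# Prefix products of the regular `N`-gon's inner products are positive definite — explicit Chebyshev coefficients

Framing: lottery ticket; floor = certified bounds/negative ranges. Venture `PackingBounds` (cell
`pub-packcert`, seat `pub-packcert-energy`). From the centred q-binomial theorem on the unit circle
(`SineBinomial.prod_eq`), at `z = e^{iθ}` and after pairing conjugate factors:

* `prod_two_cos_odd`: `∏_{i<k} (2cos θ + 2cos (2i+1)x) = S(2k,k) + 2 Σ_{c=1}^{k} S(2k,k-c) cos cθ`;
* `prod_two_cos_even`: `(2cos θ + 2) ∏_{i<k} (2cos θ + 2cos (2i+2)x) = f_{k+1} + 2 Σ_{c=1}^{k+1} f_{k+1-c} cos cθ`,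
  `f_r = S(2k+1,r) + S(2k+1,r-1)` (`fcoef`).

and the Chebyshev coefficients `conv` of a product of two cosine polynomials (`2 T_a T_b = T_{a+b} + T_{|a-b|}`,
`UniversalPolygon.cos_sum_mul_cos_sum`). At `x = π/N` (so that all `S`, `f ≥ 0`) these are the Chebyshev expansions of `∏ (t + cos ψ)` over the `k`
(resp. `k+1`) inner products `-cos ψ` of the regular `N`-gon nearest to `-1`, `N` odd (resp. even): the
positive definiteness of the partial products in Cohn–Kumar's proof (Thm. 3.1, §5.2), with explicit coefficients.

## References
* H. Cohn, A. Kumar, *Universally optimal distribution of points on spheres*, J. Amer. Math. Soc. 20 (2007)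
  99–148, Thm. 3.1, §5.2, §8. [`CohnKumar2006`]
-/

noncomputable section

namespace Summit.Ventures.PackingBounds.Energy

open Finset

namespace SineBinomial

/-! ### From the circle to cosines -/

/-- `(z + e^{-iψ})(z + e^{iψ}) = z · (2cos θ + 2cos ψ)` for `z = e^{iθ}`. [folklore] -/
theorem pair_eq (θ ψ : ℝ) :
    (Complex.exp (↑θ * Complex.I) + Complex.exp (↑(-ψ) * Complex.I)) *
        (Complex.exp (↑θ * Complex.I) + Complex.exp (↑ψ * Complex.I)) =
      Complex.exp (↑θ * Complex.I) * ((2 * Real.cos θ + 2 * Real.cos ψ : ℝ) : ℂ) := by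
  have h1 : Complex.exp (↑θ * Complex.I) * Complex.exp (-↑θ * Complex.I) = 1 := by
    rw [← Complex.exp_add, neg_mul, add_neg_cancel, Complex.exp_zero]
  have h2 : Complex.exp (-↑ψ * Complex.I) * Complex.exp (↑ψ * Complex.I) = 1 := by
    rw [← Complex.exp_add, neg_mul, neg_add_cancel, Complex.exp_zero]
  push_cast
  rw [Complex.two_cos, Complex.two_cos]
  linear_combination h2 - h1

/-- `z^c + z^{-c} = 2cos cθ` for `z = e^{iθ}`. [folklore] -/
theorem pow_add_inv_pow (θ : ℝ) (c : ℕ) :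
    Complex.exp (↑θ * Complex.I) ^ c + (Complex.exp (↑θ * Complex.I))⁻¹ ^ c =
      ((2 * Real.cos ((c : ℝ) * θ) : ℝ) : ℂ) := by
  push_cast
  rw [Complex.two_cos, ← Complex.exp_neg, ← Complex.exp_nat_mul, ← Complex.exp_nat_mul]
  congr 1
  · congr 1; ring
  · congr 1; ring

/-- Splitting a palindromic-indexed sum around its middle: `Σ_{r ≤ 2k} g_r z^{2k-r} =
z^k (g_k + Σ_{c<k} (g_{k-1-c} z^{c+1} + g_{k+1+c} z^{-(c+1)}))` (`z ≠ 0`). [folklore] -/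
theorem sum_symm_split (g : ℕ → ℂ) {z : ℂ} (hz : z ≠ 0) (k : ℕ) :
    ∑ r ∈ range (2 * k + 1), g r * z ^ (2 * k - r) =
      z ^ k * (g k + ∑ c ∈ range k, (g (k - 1 - c) * z ^ (c + 1) + g (k + 1 + c) * z⁻¹ ^ (c + 1))) := by
  have hA : ∑ r ∈ range k, g r * z ^ (2 * k - r) = ∑ c ∈ range k, z ^ k * (g (k - 1 - c) * z ^ (c + 1)) := by
    rw [← Finset.sum_range_reflect (fun r => g r * z ^ (2 * k - r)) k]
    refine Finset.sum_congr rfl fun c hc => ?_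
    have hc' := Finset.mem_range.mp hc
    rw [show 2 * k - (k - 1 - c) = k + (c + 1) by omega, pow_add]; ring
  have hB : ∑ c ∈ range k, g (k + (c + 1)) * z ^ (2 * k - (k + (c + 1))) =
      ∑ c ∈ range k, z ^ k * (g (k + 1 + c) * z⁻¹ ^ (c + 1)) := by
    refine Finset.sum_congr rfl fun c hc => ?_
    have hc' := Finset.mem_range.mp hc
    have hzk : z ^ k = z ^ (2 * k - (k + (c + 1))) * z ^ (c + 1) := by
      rw [← pow_add]; congr 1; omega
    rw [hzk, show k + (c + 1) = k + 1 + c by ring]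
    have : z ^ (c + 1) * z⁻¹ ^ (c + 1) = 1 := by rw [← mul_pow, mul_inv_cancel₀ hz, one_pow]
    linear_combination (-(g (k + 1 + c) * z ^ (2 * k - (k + 1 + c)))) * this
  rw [show 2 * k + 1 = k + (k + 1) by ring, Finset.sum_range_add,
    Finset.sum_range_succ' (fun c => g (k + c) * z ^ (2 * k - (k + c))), hA, hB,
    show 2 * k - (k + 0) = k by omega, add_zero, mul_add, Finset.mul_sum,
    Finset.sum_congr rfl fun c _ => (mul_add (z ^ k) _ _), Finset.sum_add_distrib]
  ring

/-- **Prefix products of the `N`-gon nodes, `N` odd** (`x = π/N`): for `0 < x`, `2k·x < π`,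
`∏_{i<k} (2cos θ + 2cos((2i+1)x)) = S(2k,k) + 2 Σ_{c<k} S(2k,k-1-c) cos((c+1)θ)` — a cosine polynomial with
nonnegative coefficients. [cite: CohnKumar2006, Theorem 3.1] -/
theorem prod_two_cos_odd {x : ℝ} (hx : 0 < x) (k : ℕ) (hk : ((2 * k : ℕ) : ℝ) * x < Real.pi) (θ : ℝ) :
    ∏ i ∈ range k, (2 * Real.cos θ + 2 * Real.cos ((2 * (i : ℝ) + 1) * x)) =
      sgauss x (2 * k) k +
        2 * ∑ c ∈ range k, sgauss x (2 * k) (k - 1 - c) * Real.cos (((c : ℝ) + 1) * θ) := by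
  set z : ℂ := Complex.exp (↑θ * Complex.I) with hz
  have hz0 : z ≠ 0 := Complex.exp_ne_zero _
  have key := prod_eq hx (2 * k) hk z
  have hL : ∏ j ∈ range (2 * k), (z + Complex.exp (↑((2 * (j : ℝ) - (2 * k : ℕ) + 1) * x) * Complex.I)) =
      z ^ k * ∏ i ∈ range k, ((2 * Real.cos θ + 2 * Real.cos ((2 * (i : ℝ) + 1) * x) : ℝ) : ℂ) := by
    rw [show range (2 * k) = range (k + k) by rw [two_mul], Finset.prod_range_add,
      ← Finset.prod_range_reflect _ k, ← Finset.prod_mul_distrib,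
      show z ^ k = ∏ _i ∈ range k, z by simp, ← Finset.prod_mul_distrib]
    refine Finset.prod_congr rfl fun i hi => ?_
    have hi' : i < k := Finset.mem_range.mp hi
    have hc : ((k - 1 - i : ℕ) : ℝ) = (k : ℝ) - 1 - i := by
      rw [show k - 1 - i = k - (i + 1) by omega, Nat.cast_sub (by omega)]; push_cast; ring
    have e1 : (2 * ((k - 1 - i : ℕ) : ℝ) - (2 * k : ℕ) + 1) * x = -((2 * (i : ℝ) + 1) * x) := by
      rw [hc]; push_cast; ring
    have e2 : (2 * ((k + i : ℕ) : ℝ) - (2 * k : ℕ) + 1) * x = (2 * (i : ℝ) + 1) * x := by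
      push_cast; ring
    rw [e1, e2, hz]
    exact_mod_cast pair_eq θ ((2 * (i : ℝ) + 1) * x)
  have hR : ∑ r ∈ range (2 * k + 1), (sgauss x (2 * k) r : ℂ) * z ^ (2 * k - r) =
      z ^ k * ((sgauss x (2 * k) k +
        2 * ∑ c ∈ range k, sgauss x (2 * k) (k - 1 - c) * Real.cos (((c : ℝ) + 1) * θ) : ℝ) : ℂ) := by
    rw [sum_symm_split _ hz0]
    congr 1
    push_cast
    rw [Finset.mul_sum]
    congr 1
    refine Finset.sum_congr rfl fun c hc => ?_
    have hc' : c < k := Finset.mem_range.mp hc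
    have hsymm : sgauss x (2 * k) (k + 1 + c) = sgauss x (2 * k) (k - 1 - c) := by
      rw [← sgauss_symm x (show k - 1 - c ≤ 2 * k by omega), show 2 * k - (k - 1 - c) = k + 1 + c by omega]
    rw [hsymm, hz]
    have h2 := pow_add_inv_pow θ (c + 1)
    push_cast at h2
    linear_combination (sgauss x (2 * k) (k - 1 - c) : ℂ) * h2
  rw [hL, hR] at key
  exact_mod_cast mul_left_cancel₀ (pow_ne_zero k hz0) key

/-- The coefficient list of `(z+1)·Σ_r S(n,r) z^{n-r}`: `f_r = S(n,r) + S(n,r-1)`. [folklore] -/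
def fcoef (x : ℝ) (n r : ℕ) : ℝ := sgauss x n r + if r = 0 then 0 else sgauss x n (r - 1)

/-- `f_r ≥ 0`. [folklore] -/
theorem fcoef_nonneg {x : ℝ} (hx : 0 < x) {n : ℕ} (hn : (n : ℝ) * x < Real.pi) (r : ℕ) : 0 ≤ fcoef x n r := by
  unfold fcoef
  split_ifs
  · simpa using sgauss_nonneg hx hn r
  · exact add_nonneg (sgauss_nonneg hx hn r) (sgauss_nonneg hx hn _)

/-- Palindromy `f_{n+1-r} = f_r`. [folklore] -/
theorem fcoef_symm {x : ℝ} (hx : 0 < x) {n : ℕ} (hn : (n : ℝ) * x < Real.pi) {r : ℕ} (hr : r ≤ n + 1) :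
    fcoef x n (n + 1 - r) = fcoef x n r := by
  unfold fcoef
  rcases Nat.eq_zero_or_pos r with rfl | hr0
  · simp [sgauss_of_lt (Nat.lt_succ_self n), sgauss_self hx hn, sgauss_zero_right hx hn]
  rcases Nat.lt_or_eq_of_le hr with hlt | rfl
  · rw [if_neg (by omega), if_neg (by omega), show n + 1 - r - 1 = n - r by omega,
      show n + 1 - r = n - (r - 1) by omega, sgauss_symm x (by omega), sgauss_symm x (by omega), add_comm]
  · simp [sgauss_of_lt (Nat.lt_succ_self n), sgauss_self hx hn, sgauss_zero_right hx hn]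

/-- **Prefix products of the `N`-gon nodes, `N` even** (`x = π/N`): for `0 < x`, `(2k+1)·x < π`,
`(2cos θ + 2) ∏_{i<k} (2cos θ + 2cos((2i+2)x)) = f_{k+1} + 2 Σ_{c ≤ k} f_{k-c} cos((c+1)θ)` with
`f_r = S(2k+1,r) + S(2k+1,r-1) ≥ 0`. [cite: CohnKumar2006, Theorem 3.1] -/
theorem prod_two_cos_even {x : ℝ} (hx : 0 < x) (k : ℕ) (hk : ((2 * k + 1 : ℕ) : ℝ) * x < Real.pi) (θ : ℝ) :
    (2 * Real.cos θ + 2) * ∏ i ∈ range k, (2 * Real.cos θ + 2 * Real.cos ((2 * (i : ℝ) + 2) * x)) =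
      fcoef x (2 * k + 1) (k + 1) +
        2 * ∑ c ∈ range (k + 1), fcoef x (2 * k + 1) (k - c) * Real.cos (((c : ℝ) + 1) * θ) := by
  set z : ℂ := Complex.exp (↑θ * Complex.I) with hz
  have hz0 : z ≠ 0 := Complex.exp_ne_zero _
  have key := prod_eq hx (2 * k + 1) hk z
  -- pair the factors; the middle one is `z + 1`
  have hL : ∏ j ∈ range (2 * k + 1), (z + Complex.exp (↑((2 * (j : ℝ) - (2 * k + 1 : ℕ) + 1) * x) * Complex.I)) =
      (z + 1) * (z ^ k * ∏ i ∈ range k, ((2 * Real.cos θ + 2 * Real.cos ((2 * (i : ℝ) + 2) * x) : ℝ) : ℂ)) := by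
    rw [show range (2 * k + 1) = range (k + (k + 1)) by rw [two_mul, add_assoc], Finset.prod_range_add,
      Finset.prod_range_succ' (fun j => z + Complex.exp (↑((2 * ((k + j : ℕ) : ℝ) - (2 * k + 1 : ℕ) + 1) * x) *
        Complex.I)),
      ← Finset.prod_range_reflect _ k]
    have hmid : z + Complex.exp (↑((2 * ((k + 0 : ℕ) : ℝ) - (2 * k + 1 : ℕ) + 1) * x) * Complex.I) = z + 1 := by
      rw [show (2 * ((k + 0 : ℕ) : ℝ) - (2 * k + 1 : ℕ) + 1) * x = 0 by push_cast; ring]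
      simp
    rw [hmid, show z ^ k = ∏ _i ∈ range k, z by simp]
    rw [show ∀ A B C : ℂ, A * (B * C) = C * (A * B) from fun A B C => by ring, ← Finset.prod_mul_distrib,
      ← Finset.prod_mul_distrib]
    congr 1
    refine Finset.prod_congr rfl fun i hi => ?_
    have hi' : i < k := Finset.mem_range.mp hi
    have hc : ((k - 1 - i : ℕ) : ℝ) = (k : ℝ) - 1 - i := by
      rw [show k - 1 - i = k - (i + 1) by omega, Nat.cast_sub (by omega)]; push_cast; ring
    have e1 : (2 * ((k - 1 - i : ℕ) : ℝ) - (2 * k + 1 : ℕ) + 1) * x = -((2 * (i : ℝ) + 2) * x) := by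
      rw [hc]; push_cast; ring
    have e2 : (2 * ((k + (i + 1) : ℕ) : ℝ) - (2 * k + 1 : ℕ) + 1) * x = (2 * (i : ℝ) + 2) * x := by
      push_cast; ring
    rw [e1, e2, hz]
    exact_mod_cast pair_eq θ ((2 * (i : ℝ) + 2) * x)
  -- multiply the coefficient list by `(z + 1)`
  have hR := sum_mul_linear (fun r => (sgauss x (2 * k + 1) r : ℂ)) (2 * k + 1)
    (by exact_mod_cast sgauss_of_lt (Nat.lt_succ_self _)) z 1
  have hf : ∀ r : ℕ, (sgauss x (2 * k + 1) r : ℂ) + 1 * (if r = 0 then 0 else (sgauss x (2 * k + 1) (r - 1) : ℂ)) =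
      (fcoef x (2 * k + 1) r : ℂ) := by
    intro r; unfold fcoef; split_ifs <;> push_cast <;> ring
  simp only [hf] at hR
  have hzz : (z + 1) * (z + 1) = z * ((2 * Real.cos θ + 2 : ℝ) : ℂ) := by
    have h := pair_eq θ 0
    simp only [neg_zero, Complex.ofReal_zero, zero_mul, Complex.exp_zero, Real.cos_zero, mul_one] at h
    exact h
  have key2 : z ^ (k + 1) * (((2 * Real.cos θ + 2 : ℝ) : ℂ) *
      ∏ i ∈ range k, ((2 * Real.cos θ + 2 * Real.cos ((2 * (i : ℝ) + 2) * x) : ℝ) : ℂ)) =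
      ∑ r ∈ range (2 * k + 1 + 2), (fcoef x (2 * k + 1) r : ℂ) * z ^ (2 * k + 1 + 1 - r) := by
    rw [← hR, ← key, hL, pow_succ]
    linear_combination (-(z ^ k * ∏ i ∈ range k,
      ((2 * Real.cos θ + 2 * Real.cos ((2 * (i : ℝ) + 2) * x) : ℝ) : ℂ))) * hzz
  have hS : ∑ r ∈ range (2 * k + 1 + 2), (fcoef x (2 * k + 1) r : ℂ) * z ^ (2 * k + 1 + 1 - r) =
      z ^ (k + 1) * ((fcoef x (2 * k + 1) (k + 1) +
        2 * ∑ c ∈ range (k + 1), fcoef x (2 * k + 1) (k - c) * Real.cos (((c : ℝ) + 1) * θ) : ℝ) : ℂ) := by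
    rw [show 2 * k + 1 + 2 = 2 * (k + 1) + 1 by ring, show 2 * k + 1 + 1 = 2 * (k + 1) by ring,
      sum_symm_split _ hz0 (k + 1)]
    congr 1
    push_cast
    rw [Finset.mul_sum]
    congr 1
    refine Finset.sum_congr rfl fun c hc => ?_
    have hc' : c < k + 1 := Finset.mem_range.mp hc
    have hsymm : fcoef x (2 * k + 1) (k + 1 + 1 + c) = fcoef x (2 * k + 1) (k - c) := by
      rw [← fcoef_symm hx hk (show k - c ≤ 2 * k + 1 + 1 by omega)]
      congr 1; omega
    rw [hsymm, hz]
    have h2 := pow_add_inv_pow θ (c + 1)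
    push_cast at h2
    linear_combination (fcoef x (2 * k + 1) (k - c) : ℂ) * h2
  rw [hS] at key2
  exact_mod_cast mul_left_cancel₀ (pow_ne_zero (k + 1) hz0) key2

end SineBinomial

namespace UniversalPolygon

/-! ### Products of cosine polynomials -/

/-- Chebyshev coefficients of a product: `2 T_a T_b = T_{a+b} + T_{|a-b|}`. [folklore] -/
def conv (A B : ℕ → ℝ) (dA dB c : ℕ) : ℝ :=
  ∑ a ∈ range (dA + 1), ∑ b ∈ range (dB + 1),
    A a * B b / 2 * ((if a + b = c then 1 else 0) + (if a = b + c ∨ b = a + c then 1 else 0))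

/-- `conv ≥ 0` for nonnegative coefficient lists. [folklore] -/
theorem conv_nonneg {A B : ℕ → ℝ} (hA : ∀ a, 0 ≤ A a) (hB : ∀ b, 0 ≤ B b) (dA dB c : ℕ) :
    0 ≤ conv A B dA dB c := by
  unfold conv
  refine Finset.sum_nonneg fun a _ => Finset.sum_nonneg fun b _ => mul_nonneg
    (div_nonneg (mul_nonneg (hA a) (hB b)) (by norm_num)) (add_nonneg ?_ ?_) <;> split_ifs <;> norm_num

/-- `Σ_{c<D} [a = b + c ∨ b = a + c] cos(cθ) = cos((a-b)θ)` when `|a-b| < D`. [folklore] -/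
private theorem sum_ite_absdiff (a b D : ℕ) (ha : a < D) (hb : b < D) (θ : ℝ) :
    ∑ c ∈ range D, (if a = b + c ∨ b = a + c then (1 : ℝ) else 0) * Real.cos (c * θ) =
      Real.cos (((a : ℝ) - b) * θ) := by
  rcases le_total b a with h | h
  · have key : ∀ c : ℕ, (a = b + c ∨ b = a + c) ↔ a - b = c := fun c => by omega
    simp_rw [key, ite_mul, one_mul, zero_mul]
    rw [Finset.sum_ite_eq, if_pos (Finset.mem_range.2 (by omega)), Nat.cast_sub h]
  · have key : ∀ c : ℕ, (a = b + c ∨ b = a + c) ↔ b - a = c := fun c => by omega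
    simp_rw [key, ite_mul, one_mul, zero_mul]
    rw [Finset.sum_ite_eq, if_pos (Finset.mem_range.2 (by omega)), Nat.cast_sub h, ← Real.cos_neg]
    congr 1; ring

/-- **Product of two cosine polynomials**: `(Σ_a A_a cos aθ)(Σ_b B_b cos bθ) = Σ_c conv_c cos cθ`. [folklore] -/
theorem cos_sum_mul_cos_sum (A B : ℕ → ℝ) (dA dB : ℕ) (θ : ℝ) :
    (∑ a ∈ range (dA + 1), A a * Real.cos (a * θ)) * (∑ b ∈ range (dB + 1), B b * Real.cos (b * θ)) =
      ∑ c ∈ range (dA + dB + 1), conv A B dA dB c * Real.cos (c * θ) := by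
  unfold conv
  have hR : ∑ c ∈ range (dA + dB + 1), (∑ a ∈ range (dA + 1), ∑ b ∈ range (dB + 1),
      A a * B b / 2 * ((if a + b = c then (1 : ℝ) else 0) + (if a = b + c ∨ b = a + c then (1 : ℝ) else 0))) *
        Real.cos (c * θ) =
      ∑ a ∈ range (dA + 1), ∑ b ∈ range (dB + 1), ∑ c ∈ range (dA + dB + 1),
        A a * B b / 2 * ((if a + b = c then (1 : ℝ) else 0) + (if a = b + c ∨ b = a + c then (1 : ℝ) else 0)) *
          Real.cos (c * θ) := by
    simp_rw [Finset.sum_mul]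
    rw [Finset.sum_comm]
    exact Finset.sum_congr rfl fun a _ => Finset.sum_comm
  rw [Finset.sum_mul_sum, hR]
  refine Finset.sum_congr rfl fun a ha => Finset.sum_congr rfl fun b hb => ?_
  have ha' := Finset.mem_range.1 ha
  have hb' := Finset.mem_range.1 hb
  have h1 : ∑ c ∈ range (dA + dB + 1), (if a + b = c then (1 : ℝ) else 0) * Real.cos (c * θ) =
      Real.cos (((a : ℝ) + b) * θ) := by
    simp_rw [ite_mul, one_mul, zero_mul]
    rw [Finset.sum_ite_eq, if_pos (Finset.mem_range.2 (by omega))]; push_cast; ring_nf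
  have h2 := sum_ite_absdiff a b (dA + dB + 1) (by omega) (by omega) θ
  have hsplit : ∑ c ∈ range (dA + dB + 1), A a * B b / 2 *
      ((if a + b = c then (1 : ℝ) else 0) + (if a = b + c ∨ b = a + c then (1 : ℝ) else 0)) * Real.cos (c * θ) =
      A a * B b / 2 * (∑ c ∈ range (dA + dB + 1), (if a + b = c then (1 : ℝ) else 0) * Real.cos (c * θ) +
        ∑ c ∈ range (dA + dB + 1), (if a = b + c ∨ b = a + c then (1 : ℝ) else 0) * Real.cos (c * θ)) := by
    rw [← Finset.sum_add_distrib, Finset.mul_sum]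
    exact Finset.sum_congr rfl fun c _ => by ring
  rw [hsplit, h1, h2, show ((a : ℝ) - b) * θ = a * θ - b * θ by ring, show ((a : ℝ) + b) * θ = a * θ + b * θ by ring]
  linear_combination (A a * B b / 2) * Real.two_mul_cos_mul_cos (a * θ) (b * θ)

end UniversalPolygon

end Summit.Ventures.PackingBounds.Energy

end
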